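import Literature.NumberTheory.Automorphic.ShimuraCurveRibetTakahashiFreyDiophantineProofs
import Literature.NumberTheory.DiophantineGeometry.GeneralizedFermatTwoPowerCoefficientExponentThree
import HarnessLib

/-!
# Pasten's Thm. 6.1 (b): Lemma 6.12 at `ℓ = 3` PROVED (Euler `x³ + y³ = 2z³`, Legendre
# `x³ + y³ = 4z³`), and the assembly over declarations only

Topic `NumberTheory/Automorphic`; a proofs-only companion (theorems only: no definition, no named
fact, nothing restated; D-0026) of `ShimuraCurveRibetTakahashi.lean`, written by the seat of its
named fact `Literature.NumberTheory.Automorphic.PastenShimura2024_thm_6_1_b` (H. Pasten, *Shimura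
curves and the abc conjecture*, J. Number Theory 254 (2024) 214–335 = arXiv:1705.09251, Thm. 6.1 (b)
p. 20), after `ShimuraCurveRibetTakahashiFreyDiophantineProofs.lean`.

**The point.** The finest assembly so far, `PastenShimura2024_thm_6_1_b_of_ribetTakahashi_treeFacts''`,
took Lemma 6.12 (p. 23: for a Frey–Hellegouarch curve `E_{a,b,c}` with `(a,b,c) ≠ (1,1,2)` and a
prime `ℓ ≥ 3`, the odd part of `Δ_E` is not a perfect `ℓ`-th power) from declarations for `ℓ ≥ 5`
(Wiles, Ribet 1997, Darmon–Merel 1997) and kept its case `ℓ = 3` as the hypothesis `h612₃`, because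
the printed proof there rests on Euler's `x³ + y³ = 2z³` and Legendre's `x³ + y³ = 4z³`, then absent
from Mathlib and the tree. Those two theorems are now PROVED in
`Literature/NumberTheory/DiophantineGeometry/GeneralizedFermatTwoPowerCoefficientExponentThree.lean`
(Euler's descent, *Algebra* II.XV Art. 247; Euler's lemma on `p² + 3q²` in `ℤ[ζ₃]`), packaged as
the exponent-`3` trichotomy `fermatTwoPower_three` for `x³ + 2^m y³ + z³ = 0`, `m < 3`. This file
runs Pasten's proof of Lemma 6.12 at `ℓ = 3` on it and DISCHARGES `h612₃`.

## Contents (all sorry-free)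

* `eq_one_of_ordCompl_two_mul_eq_pow_of_trichotomy` — the arithmetic of Lemma 6.12's proof for any
  odd prime `ℓ`, from the trichotomy for `x^ℓ + 2^m y^ℓ + z^ℓ = 0` as a hypothesis: coprime positive
  `a + b = c` with the odd part of `abc` an `ℓ`-th power forces `a = b = 1`;
  `eq_one_of_ordCompl_two_mul_eq_pow_three` — its case `ℓ = 3`, unconditional.
* **`IsFreyHellegouarch.ordCompl_two_minimalDiscriminantNorm_ne_pow_three`** — Lemma 6.12 at
  `ℓ = 3`, PROVED: for a Frey–Hellegouarch `W` with an odd bad prime, the odd part of `|Δ_min(W)|`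
  is not a cube; `…_ne_pow_of_three_le` — Lemma 6.12 for every prime `ℓ ≥ 3` over Mathlib's
  `FermatLastTheoremFor ℓ` and the tree's facts `ribet1997_twoPowerFermat`,
  `darmonMerel1997_denesEquation` (used only for `ℓ ≥ 5`).
* **`PastenShimura2024_thm_6_1_b_of_ribetTakahashi_treeFacts'''`** — the finest assembly: as
  `…_treeFacts''` with `h612₃` GONE. After this file `PastenShimura2024_thm_6_1_b_holds` waits
  exactly for: the named facts `mazurKenku_exists_cyclic_isogeny`, `mestreOesterle1989_thm_1`,
  `nonempty_shimuraParametrizationData`, `ribet1997_twoPowerFermat`, `darmonMerel1997_denesEquation`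
  and Mathlib's statement `FermatLastTheorem`; and the component-group package over Néron models of
  `J₀^D(M)` (`cI cJ hI hJ`, `h613` = Ribet–Takahashi 1997 Thm. 2, `hJc`, `hEis`, `h67`), which has no
  vocabulary in the tree. The whole Diophantine side of Thm. 6.1 (b) is now declarations or proved.

## References

* H. Pasten, *Shimura curves and the abc conjecture*, J. Number Theory 254 (2024) 214–335 =
  arXiv:1705.09251: Thm. 6.1 (b) p. 20; Lemma 6.12 p. 23 (proof: "the odd parts of them are perfect
  `ℓ`-th powers. Exactly one of `a,b,c` is even, so the equation `a+b=c` yields a solution of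
  `x^ℓ + 2^m y^ℓ + z^ℓ = 0` … `0 ≤ m < ℓ`"); Thm. 6.17 p. 24 (proof, case (ii)). [PastenShimura2024]
* L. Euler, *Elements of Algebra*, Part II, Ch. XV, Art. 247 (`x³ ± y³ = 2z³`). [Euler1770Algebra]
* F. Lemmermeyer, *Quadratic Number Fields* (2021), §5.2.1 p. 110 (`x³ + y³ = 2z³`; Legendre's
  `x³ + y³ = az³`, `a = 3, 4, …`). [Lemmermeyer2021]
* K. A. Ribet, Acta Arith. 79 (1997), Thm. 3. [Ribet1997] H. Darmon, L. Merel, J. reine angew.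
  Math. 490 (1997), Main Theorem (1). [DarmonMerel1997]

## Mathlib / tree search

Reused: `fermatTwoPower_three` (new, `GeneralizedFermatTwoPowerCoefficientExponentThree.lean`),
`factorization_minimalDiscriminantNorm_freyCurve_of_ne_two`,
`IsFreyHellegouarch.ordCompl_two_minimalDiscriminantNorm_ne_pow_of_five_le`,
`PastenShimura2024_thm_6_1_b_of_ribetTakahashi_treeFacts''` (`…FreyDiophantineProofs.lean`),
`exists_eq_mul_pow_of_dvd_factorization`, `factorization_minimalDiscriminantNorm_pos_of_dvd`
(`…CokernelProofs.lean`), Mathlib `exists_eq_pow_of_mul_eq_pow`, `Nat.ordProj_mul_ordCompl_eq_self`,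
`Nat.ordCompl_mul`, `Nat.factorization_ordCompl`. The three private helpers of
`…FreyDiophantineProofs.lean` §II (`exists_eq_pow_three_of_coprime`, `ordCompl_two_eq_self_of_odd`,
`two_pow_mul_pow_eq_mod`) are private there and are re-proved here privately.
-/

noncomputable section

open scoped MatrixGroups ModularForm

namespace Literature.NumberTheory.Automorphic

open Literature.NumberTheory.EllipticCurves (freyCurve mazurKenku_exists_cyclic_isogeny
  mestreOesterle1989_thm_1)
open Literature.NumberTheory.EllipticCurves.ModularForms (ModularParametrizationData IsNewformOf)
open Literature.NumberTheory.DiophantineGeometry (ribet1997_twoPowerFermat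
  darmonMerel1997_denesEquation fermatTwoPower_three)

/-! ## I. The arithmetic of Lemma 6.12 for an odd prime `ℓ`, from the trichotomy -/

/-- Pairwise coprime naturals whose product is an `n`-th power are `n`-th powers. [folklore] -/
private theorem exists_eq_pow_three_of_coprime' {x y z t n : ℕ} (hxy : x.Coprime y)
    (hxz : x.Coprime z) (hyz : y.Coprime z) (h : x * y * z = t ^ n) :
    (∃ u, x = u ^ n) ∧ (∃ v, y = v ^ n) ∧ (∃ w, z = w ^ n) := by
  have cop : ∀ {a b : ℕ}, a.Coprime b → IsUnit (gcd a b) := fun hab => Nat.isUnit_iff.mpr hab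
  refine ⟨?_, ?_, ?_⟩
  · exact exists_eq_pow_of_mul_eq_pow (cop (hxy.mul_right hxz)) (by rw [← h]; ring)
  · exact exists_eq_pow_of_mul_eq_pow (cop (hxy.symm.mul_right hyz)) (by rw [← h]; ring)
  · exact exists_eq_pow_of_mul_eq_pow (cop (hxz.symm.mul_right hyz.symm)) (by rw [← h]; ring)

/-- The odd part of an odd number is itself. [folklore] -/
private theorem ordCompl_two_eq_self_of_odd' {n : ℕ} (hn : Odd n) : ordCompl[2] n = n := by
  have h2 : ¬ 2 ∣ n := fun h => by
    obtain ⟨k, rfl⟩ := h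
    exact (Nat.not_even_iff_odd.mpr hn) (even_two_mul k)
  have : n.factorization 2 = 0 := Nat.factorization_eq_zero_of_not_dvd h2
  conv_rhs => rw [← Nat.ordProj_mul_ordCompl_eq_self n 2]
  rw [this, pow_zero, one_mul]

/-- `2^e X^ℓ = 2^{e mod ℓ} (2^{⌊e/ℓ⌋} X)^ℓ` in `ℤ`. [folklore] -/
private theorem two_pow_mul_pow_eq_mod' (e ℓ : ℕ) (X : ℤ) :
    (2 : ℤ) ^ e * X ^ ℓ = 2 ^ (e % ℓ) * (2 ^ (e / ℓ) * X) ^ ℓ := by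
  rw [mul_pow, ← pow_mul, ← mul_assoc, ← pow_add, Nat.mod_add_div']

/-- **Lemma 6.12 in `abc`-form for an odd prime `ℓ`, from the trichotomy.** If every pairwise
coprime solution of `x^ℓ + 2^m y^ℓ + z^ℓ = 0` with `m < ℓ`, `xyz ≠ 0` has `m = 1` and
`(x, y, z) = ±(1, −1, 1)`, then coprime positive `a + b = c` whose odd part of `abc` is a perfect
`ℓ`-th power have `a = b = 1`. Verbatim the tree's `eq_one_of_ordCompl_two_mul_eq_pow_prime`
(`…FreyDiophantineProofs.lean`, where the trichotomy came from Wiles–Ribet–Darmon–Merel for `ℓ ≥ 5`)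
with the trichotomy abstracted: "the odd parts of them are perfect `ℓ`-th powers. Exactly one of
`a,b,c` is even, so the equation `a+b=c` yields a solution of `x^ℓ + 2^m y^ℓ + z^ℓ = 0` … `0 ≤ m < ℓ`".
[cite: PastenShimura2024, Lemma 6.12 p. 23 (proof)] -/
theorem eq_one_of_ordCompl_two_mul_eq_pow_of_trichotomy {ℓ : ℕ} (hℓ : ℓ.Prime) (hℓ2 : ℓ ≠ 2)
    (htri : ∀ {x y z : ℤ} {m : ℕ}, m < ℓ → x ≠ 0 → y ≠ 0 → z ≠ 0 → IsCoprime x y →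
      IsCoprime x z → IsCoprime y z → x ^ ℓ + 2 ^ m * y ^ ℓ + z ^ ℓ = 0 →
      m = 1 ∧ ((x = 1 ∧ y = -1 ∧ z = 1) ∨ (x = -1 ∧ y = 1 ∧ z = -1)))
    {a b t : ℕ} (ha : 0 < a) (hb : 0 < b) (hab : a.Coprime b)
    (h : ordCompl[2] (a * b * (a + b)) = t ^ ℓ) : a = 1 ∧ b = 1 := by
  have hℓ0 : ℓ ≠ 0 := hℓ.ne_zero
  have hodd : Odd ℓ := hℓ.odd_of_ne_two hℓ2
  have hac : a.Coprime (a + b) := Nat.coprime_self_add_right.mpr hab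
  have hbc : b.Coprime (a + b) := Nat.coprime_add_self_right.mpr hab.symm
  rw [Nat.ordCompl_mul, Nat.ordCompl_mul] at h
  have hd : ∀ {m n : ℕ}, m.Coprime n → (ordCompl[2] m).Coprime (ordCompl[2] n) := fun hmn =>
    Nat.Coprime.coprime_dvd_left (Nat.ordCompl_dvd _ 2) (hmn.coprime_dvd_right (Nat.ordCompl_dvd _ 2))
  obtain ⟨⟨u, hu⟩, ⟨v, hv⟩, ⟨w, hw⟩⟩ := exists_eq_pow_three_of_coprime' (hd hab) (hd hac) (hd hbc) h
  have hu0 : u ≠ 0 := by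
    rintro rfl
    rw [zero_pow hℓ0] at hu
    exact (Nat.ordCompl_pos 2 ha.ne').ne' hu
  have hv0 : v ≠ 0 := by
    rintro rfl
    rw [zero_pow hℓ0] at hv
    exact (Nat.ordCompl_pos 2 hb.ne').ne' hv
  have hw0 : w ≠ 0 := by
    rintro rfl
    rw [zero_pow hℓ0] at hw
    exact (Nat.ordCompl_pos 2 (by omega : a + b ≠ 0)).ne' hw
  -- the roots divide the members
  have hroot : ∀ {n X : ℕ}, ordCompl[2] n = X ^ ℓ → X ∣ n := fun {n X} hn =>
    ((dvd_pow_self X hℓ0).trans (dvd_of_eq hn.symm)).trans (Nat.ordCompl_dvd n 2)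
  have hua : u ∣ a := hroot hu
  have hvb : v ∣ b := hroot hv
  have hwc : w ∣ a + b := hroot hw
  -- decompositions `n = 2^{v₂(n)} · (odd part)`
  have da := Nat.ordProj_mul_ordCompl_eq_self a 2
  have db := Nat.ordProj_mul_ordCompl_eq_self b 2
  have dc := Nat.ordProj_mul_ordCompl_eq_self (a + b) 2
  rw [hu] at da; rw [hv] at db; rw [hw] at dc
  -- the even member `n = 2^e X^ℓ`, `Y = 2^(e/ℓ) X`
  have hY : ∀ {n X : ℕ}, 2 ^ n.factorization 2 * X ^ ℓ = n →
      2 ^ (n.factorization 2 / ℓ) * X ∣ n := by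
    intro n X hn
    have h1 : 2 ^ (n.factorization 2 / ℓ) ∣ 2 ^ n.factorization 2 :=
      pow_dvd_pow 2 (Nat.div_le_self _ _)
    exact (mul_dvd_mul h1 (dvd_pow_self X hℓ0)).trans (dvd_of_eq hn)
  rcases Nat.even_or_odd a with hae | hao
  · -- `a` even, `b` and `c` odd: `v^ℓ + 2^m (2^f u)^ℓ + (−w)^ℓ = 0`
    exfalso
    have hbo : Odd b := by
      by_contra hbe
      rw [Nat.not_odd_iff_even] at hbe
      exact Nat.not_coprime_of_dvd_of_dvd (by norm_num : 1 < 2) hae.two_dvd hbe.two_dvd hab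
    have hco : Odd (a + b) := hae.add_odd hbo
    have hb' : b = v ^ ℓ := by rw [← ordCompl_two_eq_self_of_odd' hbo, hv]
    have hc' : a + b = w ^ ℓ := by rw [← ordCompl_two_eq_self_of_odd' hco, hw]
    set e := a.factorization 2 with he
    have hYa : 2 ^ (e / ℓ) * u ∣ a := hY da
    have hZ : (v : ℤ) ^ ℓ + 2 ^ (e % ℓ) * ((2 : ℤ) ^ (e / ℓ) * u) ^ ℓ + (-(w : ℤ)) ^ ℓ = 0 := by
      rw [hodd.neg_pow, ← two_pow_mul_pow_eq_mod']
      have e1 : ((a + b : ℕ) : ℤ) = (w : ℤ) ^ ℓ := by exact_mod_cast hc'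
      have e2 : ((2 ^ e * u ^ ℓ : ℕ) : ℤ) = (a : ℤ) := by exact_mod_cast da
      have e3 : (b : ℤ) = (v : ℤ) ^ ℓ := by exact_mod_cast hb'
      push_cast at e1 e2
      linear_combination e2 + e1 - e3
    have hcop : IsCoprime (v : ℤ) ((2 : ℤ) ^ (e / ℓ) * u) ∧ IsCoprime (v : ℤ) (-(w : ℤ)) ∧
        IsCoprime ((2 : ℤ) ^ (e / ℓ) * u) (-(w : ℤ)) := by
      refine ⟨?_, ?_, ?_⟩
      · have : Nat.Coprime v (2 ^ (e / ℓ) * u) :=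
          Nat.Coprime.coprime_dvd_left hvb (hab.symm.coprime_dvd_right hYa)
        exact_mod_cast Nat.isCoprime_iff_coprime.mpr this
      · have : Nat.Coprime v w := Nat.Coprime.coprime_dvd_left hvb (hbc.coprime_dvd_right hwc)
        exact (Nat.isCoprime_iff_coprime.mpr this).neg_right
      · have : Nat.Coprime (2 ^ (e / ℓ) * u) w :=
          Nat.Coprime.coprime_dvd_left hYa (hac.coprime_dvd_right hwc)
        have h' : IsCoprime ((2 ^ (e / ℓ) * u : ℕ) : ℤ) (w : ℤ) := Nat.isCoprime_iff_coprime.mpr this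
        push_cast at h'
        exact h'.neg_right
    obtain ⟨-, htriv⟩ := htri (Nat.mod_lt e hℓ.pos) (by exact_mod_cast hv0) (by positivity)
      (neg_ne_zero.mpr (by exact_mod_cast hw0)) hcop.1 hcop.2.1 hcop.2.2 hZ
    -- `|v| = |w| = 1` forces `b = c = 1`, absurd since `c = a + b > b`
    have hv1 : (v : ℤ) = 1 ∨ (v : ℤ) = -1 := by
      rcases htriv with ⟨h1, -, -⟩ | ⟨h1, -, -⟩ <;> simp [h1]
    have hw1 : (w : ℤ) = 1 ∨ (w : ℤ) = -1 := by
      rcases htriv with ⟨-, -, h1⟩ | ⟨-, -, h1⟩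
      · right; linear_combination -h1
      · left; linear_combination -h1
    have hv1' : v = 1 := by rcases hv1 with h1 | h1 <;> [exact_mod_cast h1; omega]
    have hw1' : w = 1 := by rcases hw1 with h1 | h1 <;> [exact_mod_cast h1; omega]
    rw [hv1', one_pow] at hb'
    rw [hw1', one_pow] at hc'
    omega
  · rcases Nat.even_or_odd b with hbe | hbo
    · -- `b` even, `a` and `c` odd: `u^ℓ + 2^m (2^f v)^ℓ + (−w)^ℓ = 0`
      exfalso
      have hco : Odd (a + b) := hao.add_even hbe
      have ha' : a = u ^ ℓ := by rw [← ordCompl_two_eq_self_of_odd' hao, hu]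
      have hc' : a + b = w ^ ℓ := by rw [← ordCompl_two_eq_self_of_odd' hco, hw]
      set e := b.factorization 2 with he
      have hYb : 2 ^ (e / ℓ) * v ∣ b := hY db
      have hZ : (u : ℤ) ^ ℓ + 2 ^ (e % ℓ) * ((2 : ℤ) ^ (e / ℓ) * v) ^ ℓ + (-(w : ℤ)) ^ ℓ = 0 := by
        rw [hodd.neg_pow, ← two_pow_mul_pow_eq_mod']
        have e1 : ((a + b : ℕ) : ℤ) = (w : ℤ) ^ ℓ := by exact_mod_cast hc'
        have e2 : ((2 ^ e * v ^ ℓ : ℕ) : ℤ) = (b : ℤ) := by exact_mod_cast db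
        have e3 : (a : ℤ) = (u : ℤ) ^ ℓ := by exact_mod_cast ha'
        push_cast at e1 e2
        linear_combination e2 + e1 - e3
      have hcop : IsCoprime (u : ℤ) ((2 : ℤ) ^ (e / ℓ) * v) ∧ IsCoprime (u : ℤ) (-(w : ℤ)) ∧
          IsCoprime ((2 : ℤ) ^ (e / ℓ) * v) (-(w : ℤ)) := by
        refine ⟨?_, ?_, ?_⟩
        · have : Nat.Coprime u (2 ^ (e / ℓ) * v) :=
            Nat.Coprime.coprime_dvd_left hua (hab.coprime_dvd_right hYb)
          exact_mod_cast Nat.isCoprime_iff_coprime.mpr this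
        · have : Nat.Coprime u w := Nat.Coprime.coprime_dvd_left hua (hac.coprime_dvd_right hwc)
          exact (Nat.isCoprime_iff_coprime.mpr this).neg_right
        · have : Nat.Coprime (2 ^ (e / ℓ) * v) w :=
            Nat.Coprime.coprime_dvd_left hYb (hbc.coprime_dvd_right hwc)
          have h' : IsCoprime ((2 ^ (e / ℓ) * v : ℕ) : ℤ) (w : ℤ) :=
            Nat.isCoprime_iff_coprime.mpr this
          push_cast at h'
          exact h'.neg_right
      obtain ⟨-, htriv⟩ := htri (Nat.mod_lt e hℓ.pos) (by exact_mod_cast hu0) (by positivity)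
        (neg_ne_zero.mpr (by exact_mod_cast hw0)) hcop.1 hcop.2.1 hcop.2.2 hZ
      have hu1 : (u : ℤ) = 1 ∨ (u : ℤ) = -1 := by
        rcases htriv with ⟨h1, -, -⟩ | ⟨h1, -, -⟩ <;> simp [h1]
      have hw1 : (w : ℤ) = 1 ∨ (w : ℤ) = -1 := by
        rcases htriv with ⟨-, -, h1⟩ | ⟨-, -, h1⟩
        · right; linear_combination -h1
        · left; linear_combination -h1
      have hu1' : u = 1 := by rcases hu1 with h1 | h1 <;> [exact_mod_cast h1; omega]
      have hw1' : w = 1 := by rcases hw1 with h1 | h1 <;> [exact_mod_cast h1; omega]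
      rw [hu1', one_pow] at ha'
      rw [hw1', one_pow] at hc'
      omega
    · -- `a`, `b` odd, `c` even: `u^ℓ + 2^m (−2^f w)^ℓ + v^ℓ = 0`
      have ha' : a = u ^ ℓ := by rw [← ordCompl_two_eq_self_of_odd' hao, hu]
      have hb' : b = v ^ ℓ := by rw [← ordCompl_two_eq_self_of_odd' hbo, hv]
      set e := (a + b).factorization 2 with he
      have hYc : 2 ^ (e / ℓ) * w ∣ a + b := hY dc
      have hZ : (u : ℤ) ^ ℓ + 2 ^ (e % ℓ) * (-((2 : ℤ) ^ (e / ℓ) * w)) ^ ℓ + (v : ℤ) ^ ℓ = 0 := by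
        rw [hodd.neg_pow, mul_neg, ← two_pow_mul_pow_eq_mod']
        have e2 : ((2 ^ e * w ^ ℓ : ℕ) : ℤ) = ((a + b : ℕ) : ℤ) := by exact_mod_cast dc
        have e3 : (a : ℤ) = (u : ℤ) ^ ℓ := by exact_mod_cast ha'
        have e4 : (b : ℤ) = (v : ℤ) ^ ℓ := by exact_mod_cast hb'
        push_cast at e2
        linear_combination -e2 - e3 - e4
      have hcop : IsCoprime (u : ℤ) (-((2 : ℤ) ^ (e / ℓ) * w)) ∧ IsCoprime (u : ℤ) (v : ℤ) ∧
          IsCoprime (-((2 : ℤ) ^ (e / ℓ) * w)) (v : ℤ) := by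
        refine ⟨?_, ?_, ?_⟩
        · have : Nat.Coprime u (2 ^ (e / ℓ) * w) :=
            Nat.Coprime.coprime_dvd_left hua (hac.coprime_dvd_right hYc)
          have h' : IsCoprime (u : ℤ) ((2 ^ (e / ℓ) * w : ℕ) : ℤ) := Nat.isCoprime_iff_coprime.mpr this
          push_cast at h'
          exact h'.neg_right
        · exact Nat.isCoprime_iff_coprime.mpr (Nat.Coprime.coprime_dvd_left hua
            (hab.coprime_dvd_right hvb))
        · have : Nat.Coprime (2 ^ (e / ℓ) * w) v :=
            Nat.Coprime.coprime_dvd_left hYc (hbc.symm.coprime_dvd_right hvb)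
          have h' : IsCoprime ((2 ^ (e / ℓ) * w : ℕ) : ℤ) (v : ℤ) :=
            Nat.isCoprime_iff_coprime.mpr this
          push_cast at h'
          exact h'.neg_left
      obtain ⟨-, htriv⟩ := htri (Nat.mod_lt e hℓ.pos) (by exact_mod_cast hu0)
        (neg_ne_zero.mpr (by positivity)) (by exact_mod_cast hv0) hcop.1 hcop.2.1 hcop.2.2 hZ
      have hu1 : (u : ℤ) = 1 ∨ (u : ℤ) = -1 := by
        rcases htriv with ⟨h1, -, -⟩ | ⟨h1, -, -⟩ <;> simp [h1]
      have hv1 : (v : ℤ) = 1 ∨ (v : ℤ) = -1 := by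
        rcases htriv with ⟨-, -, h1⟩ | ⟨-, -, h1⟩ <;> simp [h1]
      have hu1' : u = 1 := by rcases hu1 with h1 | h1 <;> [exact_mod_cast h1; omega]
      have hv1' : v = 1 := by rcases hv1 with h1 | h1 <;> [exact_mod_cast h1; omega]
      rw [hu1', one_pow] at ha'
      rw [hv1', one_pow] at hb'
      exact ⟨ha', hb'⟩

/-- **Lemma 6.12 in `abc`-form at `ℓ = 3`, unconditionally:** coprime positive `a + b = c` whose
odd part of `abc` is a perfect cube have `a = b = 1` — Pasten's argument fed by the exponent-`3`
trichotomy `fermatTwoPower_three` (Mathlib's `fermatLastTheoremThree`, Euler's `x³ + y³ = 2z³`,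
Legendre's `x³ + y³ = 4z³`). [cite: PastenShimura2024, Lemma 6.12 p. 23 (proof, ℓ = 3)] -/
theorem eq_one_of_ordCompl_two_mul_eq_pow_three {a b t : ℕ} (ha : 0 < a) (hb : 0 < b)
    (hab : a.Coprime b) (h : ordCompl[2] (a * b * (a + b)) = t ^ 3) : a = 1 ∧ b = 1 :=
  eq_one_of_ordCompl_two_mul_eq_pow_of_trichotomy Nat.prime_three (by norm_num)
    (fun hm hx hy hz _ hxz _ h => fermatTwoPower_three hm hx hy hz hxz h) ha hb hab h

/-! ## II. Lemma 6.12 at `ℓ = 3` for Frey–Hellegouarch curves, and for every odd prime -/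

/-- **Pasten 2024, Lemma 6.12 at `ℓ = 3`, PROVED.** For a Frey–Hellegouarch curve `W` (up to
`ℚ`-isomorphism `E_{a,b,c}`, `a, b > 0` coprime) with an odd prime of bad reduction (i.e.
`(a,b,c) ≠ (1,1,2)`), the odd part of `|Δ_min(W)|` is not a perfect cube: `v_r(Δ_min) = 2 v_r(abc)`
at odd `r` (Serre (4.1.9), tree `factorization_minimalDiscriminantNorm_freyCurve_of_ne_two`), so the
odd parts of `a, b, c` are cubes and `a + b = c` is a solution of `x³ + 2^m y³ + z³ = 0`,
`0 ≤ m < 3`: `m = 0` is Euler's Fermat theorem for cubes, `m = 2` Legendre's `x³ + y³ = 4z³` (no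
solution), `m = 1` Euler's `x³ + y³ = 2z³` (trivial solution, `abc = 2`, no odd bad prime). This was
the hypothesis `h612₃` of `PastenShimura2024_thm_6_1_b_of_ribetTakahashi_treeFacts''`.
[cite: PastenShimura2024, Lemma 6.12 p. 23] -/
theorem IsFreyHellegouarch.ordCompl_two_minimalDiscriminantNorm_ne_pow_three
    {W : WeierstrassCurve ℚ} [W.IsElliptic] (hW : IsFreyHellegouarch W)
    (hodd : ∃ q : ℕ, q.Prime ∧ q ≠ 2 ∧ q ∣ W.conductorNorm ℤ) (k : ℕ) :
    ordCompl[2] (W.minimalDiscriminantNorm ℤ) ≠ k ^ 3 := by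
  obtain ⟨a, b, C, ha, hb, hcop, hCW⟩ := hW
  obtain ⟨q, hq, hq2, hqN⟩ := hodd
  intro hk
  have habZ : IsCoprime (a : ℤ) (b : ℤ) := Nat.isCoprime_iff_coprime.mpr hcop
  have h0 : (a : ℤ) * b * (a + b) ≠ 0 := by positivity
  have hΔ : W.minimalDiscriminantNorm ℤ = (freyCurve (a : ℤ) b).minimalDiscriminantNorm ℤ := by
    rw [← WeierstrassCurve.minimalDiscriminantNorm_smul_rat W C, hCW]
  have hnat : ((a : ℤ) * b * (a + b)).natAbs = a * b * (a + b) := by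
    have : ((a : ℤ) * b * (a + b)) = ((a * b * (a + b) : ℕ) : ℤ) := by push_cast; ring
    rw [this, Int.natAbs_natCast]
  have hfac : ∀ p : ℕ, p.Prime → p ≠ 2 →
      (W.minimalDiscriminantNorm ℤ).factorization p = 2 * (a * b * (a + b)).factorization p := by
    intro p hp hp2
    rw [hΔ, factorization_minimalDiscriminantNorm_freyCurve_of_ne_two habZ h0 hp hp2, hnat,
      Nat.factorization_def _ hp]
  have hn0 : ordCompl[2] (a * b * (a + b)) ≠ 0 := (Nat.ordCompl_pos 2 (by positivity)).ne'
  -- every odd prime exponent of `abc` is divisible by `3`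
  have hdiv : ∀ p : ℕ, p.Prime → p ∉ (∅ : Finset ℕ) →
      3 ∣ (ordCompl[2] (a * b * (a + b))).factorization p := by
    intro p hp _
    rw [Nat.factorization_ordCompl]
    by_cases hp2 : p = 2
    · subst hp2; simp
    rw [Finsupp.erase_ne hp2]
    have e1 : (ordCompl[2] (W.minimalDiscriminantNorm ℤ)).factorization p =
        (W.minimalDiscriminantNorm ℤ).factorization p := by
      rw [Nat.factorization_ordCompl, Finsupp.erase_ne hp2]
    have e3 : (k ^ 3).factorization p = 3 * k.factorization p := by
      rw [Nat.factorization_pow]; simp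
    have : 2 * (a * b * (a + b)).factorization p = 3 * k.factorization p := by
      rw [← hfac p hp hp2, ← e1, hk, e3]
    exact (Nat.Coprime.dvd_of_dvd_mul_left (by norm_num : Nat.Coprime 3 2) ⟨k.factorization p, this⟩)
  obtain ⟨m, t, -, hmS, hmt⟩ := exists_eq_mul_pow_of_dvd_factorization ∅ hn0 hdiv
  have hm1 : m = 1 := Nat.eq_one_iff_not_exists_prime_dvd.mpr fun p hp hpm =>
    Finset.notMem_empty p (hmS p hp hpm)
  rw [hm1, one_mul] at hmt
  obtain ⟨rfl, rfl⟩ := eq_one_of_ordCompl_two_mul_eq_pow_three ha hb hcop hmt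
  -- now `abc = 2`: no odd prime divides `N`
  have hpos := factorization_minimalDiscriminantNorm_pos_of_dvd W hq hqN
  rw [hfac q hq hq2] at hpos
  have h2 : (1 * 1 * (1 + 1) : ℕ) = 2 := by norm_num
  rw [h2, Nat.Prime.factorization Nat.prime_two, Finsupp.single_apply, if_neg (Ne.symm hq2)] at hpos
  omega

/-- **Pasten 2024, Lemma 6.12 for every prime `ℓ ≥ 3`**, over declarations: `ℓ = 3` proved
(`…_ne_pow_three`), `ℓ ≥ 5` from Fermat's Last Theorem for `ℓ` (Mathlib's statement
`FermatLastTheoremFor ℓ`), Ribet 1997 (`ribet1997_twoPowerFermat`) and Darmon–Merel 1997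
(`darmonMerel1997_denesEquation`) through the tree's
`IsFreyHellegouarch.ordCompl_two_minimalDiscriminantNorm_ne_pow_of_five_le`.
[cite: PastenShimura2024, Lemma 6.12 p. 23] -/
theorem IsFreyHellegouarch.ordCompl_two_minimalDiscriminantNorm_ne_pow_of_three_le
    (hRib : ribet1997_twoPowerFermat) (hDM : darmonMerel1997_denesEquation) {ℓ : ℕ}
    (hℓ : ℓ.Prime) (h3 : 3 ≤ ℓ) (hFLT : FermatLastTheoremFor ℓ)
    {W : WeierstrassCurve ℚ} [W.IsElliptic] (hW : IsFreyHellegouarch W)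
    (hodd : ∃ q : ℕ, q.Prime ∧ q ≠ 2 ∧ q ∣ W.conductorNorm ℤ) (k : ℕ) :
    ordCompl[2] (W.minimalDiscriminantNorm ℤ) ≠ k ^ ℓ := by
  by_cases h5 : 5 ≤ ℓ
  · exact IsFreyHellegouarch.ordCompl_two_minimalDiscriminantNorm_ne_pow_of_five_le hRib hDM hℓ h5
      hFLT hW hodd k
  · have h4 : ℓ ≠ 4 := fun h => by norm_num [h] at hℓ
    have hℓ3 : ℓ = 3 := by omega
    subst hℓ3
    exact IsFreyHellegouarch.ordCompl_two_minimalDiscriminantNorm_ne_pow_three hW hodd k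

/-! ## III. Assembly: Thm. 6.1 (b) over declarations only -/

/-- **Pasten 2024, Thm. 6.1 (b) over the tree's facts — the trust base after this file.** As
`PastenShimura2024_thm_6_1_b_of_ribetTakahashi_treeFacts''` (`…FreyDiophantineProofs.lean`) with its
last hypothesis `h612₃` (Lemma 6.12 at `ℓ = 3`) DISCHARGED by
`IsFreyHellegouarch.ordCompl_two_minimalDiscriminantNorm_ne_pow_three` (Euler's `x³ + y³ = 2z³`,
Legendre's `x³ + y³ = 4z³`, Euler's Fermat theorem for cubes). So `PastenShimura2024_thm_6_1_b_holds`
now waits exactly for: the named facts `mazurKenku_exists_cyclic_isogeny` (Mazur 1978 + Kenku 1982),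
`mestreOesterle1989_thm_1`, `nonempty_shimuraParametrizationData` (Jacquet–Langlands),
`ribet1997_twoPowerFermat`, `darmonMerel1997_denesEquation`, Mathlib's statement `FermatLastTheorem`
(Wiles, Taylor–Wiles); and the component-group package over Néron models of `J₀^D(M)` — the functions
`cI = i_p`, `cJ = j_p` with `h613` (Ribet–Takahashi 1997 Thm. 2 = Prop. 6.13), `hJc`
(`j_p ∣ #Φ_p(A) = v_p(Δ)`), `hEis` (Ribet's Eisenstein property of `i_p`), `h67` (Lemma 6.7) — which
has no vocabulary in the tree. Every Diophantine input of the printed proof is now a declaration or a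
theorem. [cite: PastenShimura2024, Thm. 6.1 (b) p. 20, §6.3–6.9 pp. 21–25] -/
theorem PastenShimura2024_thm_6_1_b_of_ribetTakahashi_treeFacts'''
    (hMK : mazurKenku_exists_cyclic_isogeny) (hMO : mestreOesterle1989_thm_1)
    (hP : nonempty_shimuraParametrizationData)
    (hRib : ribet1997_twoPowerFermat) (hDM : darmonMerel1997_denesEquation)
    (hFLT : FermatLastTheorem)
    (cI cJ : ∀ {D M : ℕ} {X : ShimuraCurveData D M} {W' : WeierstrassCurve ℚ},
      ShimuraParametrizationData X W' → ℕ → ℕ)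
    (hI : ∀ {D M : ℕ} {X : ShimuraCurveData D M} {W' : WeierstrassCurve ℚ}
      (P : ShimuraParametrizationData X W') (p : ℕ), 0 < cI P p)
    (hJ : ∀ {D M : ℕ} {X : ShimuraCurveData D M} {W' : WeierstrassCurve ℚ}
      (P : ShimuraParametrizationData X W') (p : ℕ), 0 < cJ P p)
    (h613 : ∀ {N d M₁ D M p r : ℕ}, p.Prime → r.Prime → p ≠ r → D = d * (p * r) →
      M₁ = p * r * M → IsAdmissibleFactorization N D M →
      ∀ (X₁ : ShimuraCurveData d M₁) (X₂ : ShimuraCurveData D M)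
        (W : WeierstrassCurve ℚ) [W.IsElliptic] [W.IsGloballyMinimal], W.conductorNorm ℤ = N →
      ∀ (W₁' : WeierstrassCurve ℚ) [W₁'.IsElliptic] (P₁ : ShimuraParametrizationData X₁ W₁'),
        P₁.IsMinimalFor W →
      ∀ (W₂' : WeierstrassCurve ℚ) [W₂'.IsElliptic] (P₂ : ShimuraParametrizationData X₂ W₂'),
        P₂.IsMinimalFor W →
        P₁.deg * (cI P₁ p ^ 2 * cJ P₂ r ^ 2) =
          P₂.deg * ((W₁'.minimalDiscriminantNorm ℤ).factorization p *
            (W₂'.minimalDiscriminantNorm ℤ).factorization r))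
    (hJc : ∀ {N D M : ℕ}, IsAdmissibleFactorization N D M →
      ∀ (X : ShimuraCurveData D M) (W : WeierstrassCurve ℚ) [W.IsElliptic] [W.IsGloballyMinimal],
        W.conductorNorm ℤ = N →
      ∀ (W' : WeierstrassCurve ℚ) [W'.IsElliptic] (P : ShimuraParametrizationData X W'),
        P.IsMinimalFor W → ∀ p : ℕ, p.Prime → p ∣ D →
        cJ P p ∣ (W'.minimalDiscriminantNorm ℤ).factorization p)
    {S : Finset ℕ} (h2S : 2 ∈ S)
    (hEis : ∀ {N D M : ℕ}, IsAdmissibleFactorization N D M →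
      ∀ (X : ShimuraCurveData D M) (W : WeierstrassCurve ℚ) [W.IsElliptic] [W.IsGloballyMinimal],
        W.conductorNorm ℤ = N →
      ∀ (W' : WeierstrassCurve ℚ) [W'.IsElliptic] (P : ShimuraParametrizationData X W'),
        P.IsMinimalFor W → ∀ p : ℕ, p.Prime → p ∣ M → ¬ p ^ 2 ∣ M →
        ∀ r : ℕ, r.Prime → ¬ r ∣ N → (cI P p : ℤ) ∣ (r + 1 : ℤ) - W'.LFunction r)
    (h67 : ∀ ℓ : ℕ, ℓ.Prime → ∃ β : ℕ, (163 < ℓ → β = 1) ∧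
      ∀ (A : WeierstrassCurve ℚ) [A.IsElliptic],
        (∀ q : ℕ, q.Prime → q ∉ S → ¬ q ^ 2 ∣ A.conductorNorm ℤ) →
        ∀ r₀ : ℕ, ∃ r : ℕ, r₀ < r ∧ r.Prime ∧ ¬ ((ℓ ^ β : ℕ) : ℤ) ∣ (r + 1 : ℤ) - A.LFunction r) :
    PastenShimura2024_thm_6_1_b :=
  PastenShimura2024_thm_6_1_b_of_ribetTakahashi_treeFacts'' hMK hMO hP hRib hDM hFLT cI cJ hI hJ
    h613 hJc h2S hEis h67
    (fun _W _ hFH hodd k =>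
      IsFreyHellegouarch.ordCompl_two_minimalDiscriminantNorm_ne_pow_three hFH hodd k)

end Literature.NumberTheory.Automorphic

end
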